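import Literature.AlgebraicGeometry.Resolution.DeeplyRamifiedKrasner
import Literature.AlgebraicGeometry.Resolution.TameTowerPGroupTowers
import Literature.AlgebraicGeometry.Resolution.OstrowskiRamification
import Literature.AlgebraicGeometry.Resolution.GeneralizedStabilityRankOneVT
import Literature.AlgebraicGeometry.Resolution.Kuhlmann2019Lemma47
import Mathlib.FieldTheory.Perfect
import Mathlib.FieldTheory.Extension
import Mathlib.GroupTheory.Sylow
import HarnessLib

/-!
# Krasner radius = distance to the ground field for every algebraic element (Temkin 2013, Prop. 3.1.7)

Topic: `Literature/AlgebraicGeometry/Resolution` (valued function fields). M. Temkin,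
*Inseparable local uniformization*, J. Algebra 373 (2013) 65–119 = arXiv:0804.1554, §3.1
"Discs over perfect analytic fields" (numbering of the earlier arXiv version held in the
literature store, as in the companion files `DeeplyRamifiedKrasner.lean`,
`InseparableLocalUniformizationCurves*.lean`), continuing `DeeplyRamifiedKrasner.lean`
(Lemma 3.1.6) towards Cor. 3.1.10 and Thm. 3.2.3 — the valuation-theoretic inputs of Thm. 3.3.1
(the named fact `Temkin2013RelativeCurveSmoothFibre`, `InseparableLocalUniformizationCurvesStepOne.lean`):

> **Proposition 3.1.7.** Assume that `k` is deeply ramified, and let `α ∈ k^a` be an element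
> with conjugates `α₁ = α, α₂, …, α_d`. Then `max_{1 ≤ i ≤ d} |α − αᵢ| = inf_{c ∈ k} |α − c|`.

("an equicharacteristic valued field `k` is deeply ramified if and only if it is perfect",
p. 21.) PROVED here in the equal characteristic case, in the ambient rendering of the tree (one
algebraically closed valued field `(Ω, V)` of characteristic `p`, a subfield `E ≤ Ω` henselian
for `V ∩ E` (`IsHenselianField`), perfect, of rank one (`IsRankOneValued`); `α ∈ Ω` algebraic
over `E`; "complete" weakened to "henselian" as in Lemma 3.1.6).

## The proof formalized

The inequality `max ≤ inf` is Krasner's lemma (`valuation_sub_le_of_mem_aroots_minpoly`). For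
`inf ≤ max` the printed proof (pp. 21–22) embeds `k(α)` into a tower
`k = k₀ ⊂ k₁ ⊂ ⋯ ⊂ k_n` whose steps are (i) wildly ramified Galois of degree `p` (Lemma 3.1.6),
(ii) moderately ramified of prime degree, (iii) unramified ("by the standard theories of valued
fields and `p`-groups"), and inducts on `n` with the following step: if the Proposition holds
for `α` over `k₁` and for every element of `k₁` over `k₀`, it holds for `α` over `k₀` (either
`inf_{k₁} = inf_{k₀}`, or some `β ∈ k₁` has `|α − β| < inf_{c ∈ k₀} |α − c| = inf_c |β − c|
`= |β − β₂|` for a conjugate `β₂` of `β`, and conjugating `(β, α) ↦ (β₂, αᵢ)` over the henselian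
`k₀` gives `|α − αᵢ| = |β − β₂|`). This file proves that induction step verbatim
(`exists_aroots_valuation_le_step`) and runs it along a tower which needs NO ramification
theory: with `M ≤ Ω` the splitting field of `minpoly_E α` (finite Galois over the perfect `E`)
and `P` a `p`-Sylow subgroup of `Gal(M|E)`,
`E ≤ M^P = T₀ ≤ T₁ ≤ ⋯ ≤ T_s = M`, `[T_{j+1} : T_j] = p`
(`isNormalPTower_top_of_isGalois_of_isPGroup`, `TameTowerPGroupTowers.lean`). Every element of
`T_{j+1}` lies in `T_j` or has degree `p` over the perfect henselian rank-one `T_j`, so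
Lemma 3.1.6 (`DeeplyRamifiedKrasner.lean`, which needs only `deg minpoly = p`) applies; and every
`β ∈ M^P` has degree `n` prime to `p` over `E`, where the Proposition is the **trace trick**:
`t = Tr(β)/n ∈ E` has `β − t = (1/n) ∑ᵢ (β − βᵢ)`, so `|β − t| ≤ maxᵢ |β − βᵢ|`
(`exists_mem_valuation_sub_le_of_valuation_natDegree_eq_one`; this covers the printed cases
(ii)–(iii) and more, over any subfield).

## Content (everything PROVED; no definitions, no named facts)

* Bookkeeping: `isIntegral_of_subfield_le`, `mem_aroots_minpoly_of_subfield_le`,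
  `self_mem_aroots_minpoly`, `exists_max_aroots_minpoly`, `valuation_multiset_sum_le`,
  `forall_exists_pow_eq_of_algebraic` (perfectness ascends along algebraic extensions).
* The property "every lower bound `|g|` of `{|α − c| : c ∈ K}` is `≤ |α − β|` for some
  `K`-conjugate `β`" in its trivial cases: `exists_aroots_valuation_le_of_mem` (`α ∈ K`),
  `exists_mem_valuation_sub_le_of_valuation_natDegree_eq_one`,
  `exists_aroots_valuation_le_of_valuation_natDegree_eq_one` (trace trick, `|deg| = 1`),
  `exists_aroots_valuation_le_of_natDegree_eq` (degree `p`, Lemma 3.1.6).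
* `exists_aroots_valuation_le_step` — **the printed induction step** [cite: Temkin2013,
  Prop. 3.1.7 (proof)].
* `exists_aroots_valuation_le_of_isNormalStep`, `exists_aroots_valuation_le_of_isNormalPTower` —
  descent along steps of degree `p`.
* `exists_aroots_valuation_le_of_perfect`,
  `exists_conj_krasnerRadius_eq_dist_of_isIntegral_of_perfect` — **Prop. 3.1.7**
  [cite: Temkin2013, Prop. 3.1.7].

## Sources

* M. Temkin, *Inseparable local uniformization*, J. Algebra 373 (2013) 65–119 = arXiv:0804.1554:
  §3.1, Lemma 3.1.3 (ii), Lemma 3.1.6, Prop. 3.1.7 and its proof (pp. 21–22 of the held arXiv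
  text). [Temkin2013]
* Field theory used for the tower: Sylow subgroups and maximal subgroup chains of `p`-groups via
  the Galois correspondence (Mathlib; `TameTowerPGroupTowers.lean`, `TameTowerRebase.lean`).
  [folklore]

## Rendering notes

* As in `DeeplyRamifiedKrasner.lean`, values are multiplicative (`V.valuation`) and
  "`max_β |α − β| = inf_{c ∈ E} |α − c|`" is rendered without real numbers by: for every `g`
  algebraic over `E`, if `|g| ≤ |α − c|` for all `c ∈ E` then `|g| ≤ |α − β|` for some conjugate
  `β` (equivalently — contrapositive — if `|g|` exceeds the Krasner radius then some `c ∈ E` has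
  `|α − c| < |g|`), together with Krasner's inequality. The values of elements algebraic over `E`
  are the meaningful thresholds (cofinal around the radius in rank one).
* The induction step is stated for an arbitrary class `Q` of test elements `g` (it is pure
  ultrametric geometry plus the invariance of `|·|` under `K₀`-embeddings,
  `IsHenselianField.valuation_algHom_apply`); the class "algebraic over `E`" is needed only in the
  degree-`p` case (archimedean property).
* `[CharP (ResidueField V) p]` (residue characteristic `p`, automatic from `[CharP Ω p]`) is
  carried as an instance hypothesis as in the `Kuhlmann2019*.lean` files; it gives `|n| = 1` for
  `n` prime to `p` (`valuation_natCast_eq_one_of_residue_ne_zero`).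
-/

noncomputable section

open Polynomial IntermediateField Module

namespace Literature.AlgebraicGeometry.Resolution

universe u

variable {Ω : Type u} [Field Ω] [IsAlgClosed Ω] (V : ValuationSubring Ω)

/-! ### Bookkeeping on conjugates over nested subfields -/

section Bookkeeping

omit [IsAlgClosed Ω] in
/-- Integrality ascends along `K₀ ≤ K₁`. [folklore] -/
theorem isIntegral_of_subfield_le {K₀ K₁ : Subfield Ω} (h : K₀ ≤ K₁) {x : Ω}
    (hx : IsIntegral K₀ x) : IsIntegral K₁ x :=
  (isAlgebraic_of_subfield_le h hx.isAlgebraic).isIntegral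

omit [IsAlgClosed Ω] in
/-- The conjugates of `α` over a larger field are among its conjugates over a smaller one: a
root of `minpoly_{K₁} α` is a root of `minpoly_{K₀} α` (`K₀ ≤ K₁`). [folklore] -/
theorem mem_aroots_minpoly_of_subfield_le {K₀ K₁ : Subfield Ω} (h : K₀ ≤ K₁) {α : Ω}
    (hα : IsIntegral K₀ α) {β : Ω} (hβ : β ∈ (minpoly K₁ α).aroots Ω) :
    β ∈ (minpoly K₀ α).aroots Ω := by
  letI : Algebra K₀ K₁ := (Subfield.inclusion h).toAlgebra
  haveI : IsScalarTower K₀ K₁ Ω := IsScalarTower.of_algebraMap_eq fun _ => rfl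
  rw [mem_aroots] at hβ ⊢
  refine ⟨minpoly.ne_zero hα, ?_⟩
  have hdvd : minpoly K₁ α ∣ (minpoly K₀ α).map (algebraMap K₀ K₁) :=
    minpoly.dvd_map_of_isScalarTower K₀ K₁ α
  obtain ⟨q, hq⟩ := hdvd
  have : aeval β ((minpoly K₀ α).map (algebraMap K₀ K₁)) = 0 := by
    rw [hq, map_mul, hβ.2, zero_mul]
  rwa [aeval_map_algebraMap] at this

omit [IsAlgClosed Ω] in
/-- `α` is a root of its own minimal polynomial. [folklore] -/
theorem self_mem_aroots_minpoly {K : Subfield Ω} {α : Ω} (hα : IsIntegral K α) :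
    α ∈ (minpoly K α).aroots Ω := by
  rw [mem_aroots]
  exact ⟨minpoly.ne_zero hα, minpoly.aeval K α⟩

omit [IsAlgClosed Ω] in
/-- A conjugate of `α` at maximal distance exists. [folklore] -/
theorem exists_max_aroots_minpoly {K : Subfield Ω} {α : Ω} (hα : IsIntegral K α) :
    ∃ β₀ ∈ (minpoly K α).aroots Ω,
      ∀ β ∈ (minpoly K α).aroots Ω, V.valuation (α - β) ≤ V.valuation (α - β₀) := by
  classical
  set S := (minpoly K α).aroots Ω with hS
  have hSne : S.toFinset.Nonempty := ⟨α, Multiset.mem_toFinset.mpr (self_mem_aroots_minpoly hα)⟩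
  obtain ⟨β₀, hβ₀S, hβ₀max⟩ := S.toFinset.exists_max_image (fun β => V.valuation (α - β)) hSne
  exact ⟨β₀, Multiset.mem_toFinset.mp hβ₀S, fun β hβ => hβ₀max β (Multiset.mem_toFinset.mpr hβ)⟩

omit [IsAlgClosed Ω] in
/-- The ultrametric inequality for multiset sums. [folklore] -/
theorem valuation_multiset_sum_le {g : V.ValueGroup} :
    ∀ s : Multiset Ω, (∀ x ∈ s, V.valuation x ≤ g) → V.valuation s.sum ≤ g := by
  intro s
  induction s using Multiset.induction_on with
  | empty => intro _; simp
  | cons x s ih =>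
    intro hs
    rw [Multiset.sum_cons]
    exact le_trans (Valuation.map_add _ _ _)
      (max_le (hs x (Multiset.mem_cons_self x s)) (ih fun y hy => hs y (Multiset.mem_cons_of_mem hy)))

end Bookkeeping

/-! ### The predicate "Krasner radius = distance" and its trivial cases -/

section Predicate

omit [IsAlgClosed Ω] in
/-- **The element itself**: if `α ∈ K` then trivially every lower bound `|g|` of the distances
`|α − c|`, `c ∈ K`, is bounded by the distance to a conjugate (namely `|g| ≤ |α − α| = 0`).
[folklore] -/
theorem exists_aroots_valuation_le_of_mem {K : Subfield Ω} {α : Ω} (hαK : α ∈ K) {g : Ω}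
    (hg : ∀ c ∈ K, V.valuation g ≤ V.valuation (α - c)) :
    ∃ β ∈ (minpoly K α).aroots Ω, V.valuation g ≤ V.valuation (α - β) := by
  have hα : IsIntegral K α := isIntegral_algebraMap (x := (⟨α, hαK⟩ : K))
  exact ⟨α, self_mem_aroots_minpoly hα, hg α hαK⟩

/-- **The trace trick (degree prime to the residue characteristic)**: if `β` is algebraic over
the subfield `K ≤ Ω` with minimal polynomial of degree `n` and `|n| = 1`, then the element
`t = Tr(β)/n = −a_{n-1}/n ∈ K` satisfies `|β − t| ≤ max_{β'} |β − β'|` over the conjugates `β'`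
of `β`: indeed `β − t = (1/n) ∑_{β'} (β − β')`. (Over a henselian `K` the reverse inequality is
Krasner's lemma, so `t` realizes `inf_{c ∈ K} |β − c| = max_{β'} |β − β'|`; this replaces cases
(ii) "moderately ramified of prime degree" and (iii) "unramified" of the printed proof of
Temkin 2013, Prop. 3.1.7.) [folklore] -/
theorem exists_mem_valuation_sub_le_of_valuation_natDegree_eq_one {K : Subfield Ω} {β : Ω}
    (hβ : IsIntegral K β) (hn : V.valuation ((minpoly K β).natDegree : Ω) = 1) :
    ∃ t ∈ K, ∃ β₀ ∈ (minpoly K β).aroots Ω, V.valuation (β - t) ≤ V.valuation (β - β₀) := by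
  classical
  obtain ⟨β₀, hβ₀, hmax⟩ := exists_max_aroots_minpoly V hβ
  set f := minpoly K β with hf
  set S := f.aroots Ω with hS
  set n := f.natDegree with hndef
  have hsplit : (f.map (algebraMap K Ω)).Splits := IsAlgClosed.splits _
  have hmonic : (f.map (algebraMap K Ω)).Monic := (minpoly.monic hβ).map _
  have hcard : Multiset.card S = n := by
    rw [hS, aroots, ← hsplit.natDegree_eq_card_roots, natDegree_map]
  have hsum : S.sum = -(algebraMap K Ω f.nextCoeff) := by
    have h1 := hsplit.nextCoeff_eq_neg_sum_roots_of_monic hmonic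
    rw [nextCoeff_map (algebraMap K Ω).injective] at h1
    rw [hS, aroots, ← neg_neg (Multiset.sum _), ← h1]
  have hn0 : (n : Ω) ≠ 0 := fun h0 => by
    rw [h0, map_zero] at hn
    exact zero_ne_one hn
  -- `t = Tr(β)/n`
  refine ⟨S.sum / n, ?_, β₀, hβ₀, ?_⟩
  · rw [hsum]
    exact K.div_mem (K.neg_mem (SetLike.coe_mem _)) (natCast_mem K n)
  · have hid : β - S.sum / n = (S.map fun β' => β - β').sum / n := by
      rw [Multiset.sum_map_sub, Multiset.map_const', Multiset.sum_replicate, Multiset.map_id',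
        hcard, nsmul_eq_mul]
      field_simp
    rw [hid, map_div₀, hn, div_one]
    refine valuation_multiset_sum_le V _ fun x hx => ?_
    obtain ⟨β', hβ', rfl⟩ := Multiset.mem_map.mp hx
    exact hmax β' hβ'

/-- The trace trick in predicate form: every lower bound `|g|` of `{|β − c| : c ∈ K}` is at most
the distance from `β` to one of its conjugates, when `|deg_K β| = 1`. [folklore] -/
theorem exists_aroots_valuation_le_of_valuation_natDegree_eq_one {K : Subfield Ω} {β : Ω}
    (hβ : IsIntegral K β) (hn : V.valuation ((minpoly K β).natDegree : Ω) = 1) {g : Ω}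
    (hg : ∀ c ∈ K, V.valuation g ≤ V.valuation (β - c)) :
    ∃ β₀ ∈ (minpoly K β).aroots Ω, V.valuation g ≤ V.valuation (β - β₀) := by
  obtain ⟨t, htK, β₀, hβ₀, hle⟩ :=
    exists_mem_valuation_sub_le_of_valuation_natDegree_eq_one V hβ hn
  exact ⟨β₀, hβ₀, (hg t htK).trans hle⟩

/-- The degree-`p` case (Temkin 2013, Lemma 3.1.6, `DeeplyRamifiedKrasner.lean`) in predicate
form: over a perfect henselian subfield `K` of rank one (characteristic `p`), for `α` with minimal
polynomial of degree `p`, every `g` algebraic over `K` with `|g| ≤ |α − c|` for all `c ∈ K` has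
`|g| ≤ |α − β|` for some conjugate `β`. [cite: Temkin2013, Lemma 3.1.6] -/
theorem exists_aroots_valuation_le_of_natDegree_eq (p : ℕ) [Fact p.Prime] [CharP Ω p]
    {K : Subfield Ω} (hK : IsHenselianField K (V.comap (algebraMap K Ω)))
    (hperf : ∀ y ∈ K, ∃ b ∈ K, b ^ p = y) (hr1 : IsRankOneValued V K) {α : Ω}
    (hα : IsIntegral K α) (hdeg : (minpoly K α).natDegree = p) {g : Ω} (hgalg : IsAlgebraic K g)
    (hg : ∀ c ∈ K, V.valuation g ≤ V.valuation (α - c)) :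
    ∃ β ∈ (minpoly K α).aroots Ω, V.valuation g ≤ V.valuation (α - β) := by
  obtain ⟨β₀, hβ₀, -, -, hthr⟩ := exists_conj_krasnerRadius_eq_dist_of_perfect V p hK hperf hr1 hα hdeg
  refine ⟨β₀, hβ₀, not_lt.mp fun hlt => ?_⟩
  obtain ⟨c, hcK, hc⟩ := hthr g hgalg hlt
  exact absurd (hg c hcK) (not_le.mpr hc)

end Predicate

/-! ### The induction step (Temkin 2013, proof of Prop. 3.1.7) -/

section Step

/-- **The induction step of the proof of Temkin 2013, Prop. 3.1.7.** Let `K₀ ≤ K₁` be subfields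
of `Ω` with `K₀` henselian and `K₁` algebraic over `K₀`, and `α` algebraic over `K₀`. Suppose the
property "every (algebraic) lower bound `|g|` of the distances to the field is at most the distance
to some conjugate" holds for `α` over `K₁` and for every element of `K₁` over `K₀`. Then it holds
for `α` over `K₀` (the test elements `g` range over any class `Q`, in the application the
elements algebraic over the ground field). Printed proof (pp. 21–22): with `r_i = inf_{c ∈ k_i} |α − c|`, either
`r_1 = r_0` — then the conjugates over `k_1` are conjugates over `k_0` — or `r_1 < r_0`, i.e.
`|α − β| < r_0` for some `β ∈ k_1`; then `inf_c |β − c| = r_0`, so `|β − β₂| = r_0` for a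
conjugate `β₂` of `β`, and conjugating `β ↦ β₂`, `α ↦ αᵢ` (values are preserved over the
henselian `k_0`) gives `|α − αᵢ| = |β − β₂| = r_0`. PROVED. [cite: Temkin2013, Prop. 3.1.7 (proof)] -/
theorem exists_aroots_valuation_le_step {K₀ K₁ : Subfield Ω} (h01 : K₀ ≤ K₁)
    (hK₀ : IsHenselianField K₀ (V.comap (algebraMap K₀ Ω)))
    (halg₁ : ∀ y ∈ K₁, IsAlgebraic K₀ y) {α : Ω} (hα : IsIntegral K₀ α) (Q : Ω → Prop)
    (hα₁ : ∀ g : Ω, Q g → (∀ c ∈ K₁, V.valuation g ≤ V.valuation (α - c)) →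
      ∃ β ∈ (minpoly K₁ α).aroots Ω, V.valuation g ≤ V.valuation (α - β))
    (hK₁ : ∀ β ∈ K₁, ∀ g : Ω, Q g → (∀ c ∈ K₀, V.valuation g ≤ V.valuation (β - c)) →
      ∃ β₂ ∈ (minpoly K₀ β).aroots Ω, V.valuation g ≤ V.valuation (β - β₂))
    {g : Ω} (hgalg : Q g) (hg : ∀ c ∈ K₀, V.valuation g ≤ V.valuation (α - c)) :
    ∃ α' ∈ (minpoly K₀ α).aroots Ω, V.valuation g ≤ V.valuation (α - α') := by
  classical
  by_cases hcase : ∀ c ∈ K₁, V.valuation g ≤ V.valuation (α - c)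
  · -- `r₁ = r₀`: a conjugate over `K₁` is a conjugate over `K₀`
    obtain ⟨β, hβ, hle⟩ := hα₁ g hgalg hcase
    exact ⟨β, mem_aroots_minpoly_of_subfield_le h01 hα hβ, hle⟩
  · -- `r₁ < r₀`: some `β ∈ K₁` is closer to `α` than `|g|`
    push Not at hcase
    obtain ⟨β, hβK₁, hβlt⟩ := hcase
    -- `|β - c| = |α - c| ≥ |g|` for `c ∈ K₀`
    have hβc : ∀ c ∈ K₀, V.valuation g ≤ V.valuation (β - c) := by
      intro c hc
      have h1 : V.valuation (α - β) < V.valuation (α - c) := lt_of_lt_of_le hβlt (hg c hc)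
      have h2 : V.valuation (β - c) = V.valuation (α - c) := by
        have hid : β - c = (α - c) - (α - β) := by ring
        rw [hid]
        exact Valuation.map_sub_eq_of_lt_left _ h1
      rw [h2]
      exact hg c hc
    obtain ⟨β₂, hβ₂, hgβ₂⟩ := hK₁ β hβK₁ g hgalg hβc
    -- `|α - β| < |β - β₂|`
    have hlt : V.valuation (α - β) < V.valuation (β - β₂) := lt_of_lt_of_le hβlt hgβ₂
    -- conjugate `β ↦ β₂`, `α ↦ α'` over `K₀`
    have hβint : IsIntegral K₀ β := (halg₁ β hβK₁).isIntegral
    set S : Set Ω := {β, α} with hSdef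
    have hS : ∀ s ∈ S, IsIntegral K₀ s ∧ ((minpoly K₀ s).map (algebraMap K₀ Ω)).Splits := by
      intro s hs
      rcases hs with rfl | rfl
      · exact ⟨hβint, IsAlgClosed.splits _⟩
      · exact ⟨hα, IsAlgClosed.splits _⟩
    have hβS : β ∈ adjoin K₀ S := subset_adjoin K₀ S (by simp [hSdef])
    have hαS : α ∈ adjoin K₀ S := subset_adjoin K₀ S (by simp [hSdef])
    have hβ₂root : aeval β₂ (minpoly K₀ β) = 0 := (mem_aroots.mp hβ₂).2
    obtain ⟨φ, hφβ⟩ := exists_algHom_adjoin_of_splits_of_aeval hS hβS hβ₂root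
    haveI : Algebra.IsAlgebraic K₀ (adjoin K₀ S) := isAlgebraic_adjoin fun s hs => (hS s hs).1
    set α' : Ω := φ ⟨α, hαS⟩ with hα'def
    have hα'root : α' ∈ (minpoly K₀ α).aroots Ω := by
      rw [mem_aroots]
      refine ⟨minpoly.ne_zero hα, ?_⟩
      have h1 : minpoly K₀ (⟨α, hαS⟩ : adjoin K₀ S) = minpoly K₀ α :=
        (minpoly.algebraMap_eq (A := K₀) (algebraMap (adjoin K₀ S) Ω).injective ⟨α, hαS⟩).symm
      rw [hα'def, ← h1, aeval_algHom_apply, minpoly.aeval, map_zero]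
    -- values are preserved: `|α' - β₂| = |α - β|`
    have hval : V.valuation (α' - β₂) = V.valuation (α - β) := by
      have h1 := hK₀.valuation_algHom_apply V φ (⟨α, hαS⟩ - ⟨β, hβS⟩)
      rw [map_sub, hφβ] at h1
      rw [hα'def, h1]
      rfl
    refine ⟨α', hα'root, ?_⟩
    -- `α - α' = (α - β) + (β - β₂) - (α' - β₂)` with the middle term dominating
    have hid : α - α' = (β - β₂) + ((α - β) - (α' - β₂)) := by ring
    have hsmall : V.valuation ((α - β) - (α' - β₂)) < V.valuation (β - β₂) := by
      refine lt_of_le_of_lt (Valuation.map_sub _ _ _) (max_lt hlt ?_)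
      rw [hval]; exact hlt
    rw [hid, Valuation.map_add_eq_of_lt_left _ hsmall]
    exact hgβ₂

end Step

/-! ### Along a tower of steps of degree `p` over a deeply ramified field -/

section Tower

variable (p : ℕ) [hp : Fact p.Prime] [CharP Ω p]

omit [IsAlgClosed Ω] in
/-- **Perfectness ascends along algebraic extensions** inside `Ω` (characteristic `p`): if every
element of `E` is a `p`-th power in `E` and `T ≥ E` is algebraic over `E`, then every element of
`T` is a `p`-th power in `T` (an algebraic extension of a perfect field is perfect,
`Algebra.IsAlgebraic.perfectField`). [folklore] -/
theorem forall_exists_pow_eq_of_algebraic {E T : Subfield Ω} (hET : E ≤ T)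
    (hperf : ∀ y ∈ E, ∃ b ∈ E, b ^ p = y) (halg : ∀ y ∈ T, IsAlgebraic E y) :
    ∀ y ∈ T, ∃ b ∈ T, b ^ p = y := by
  haveI : ExpChar E p := ExpChar.prime hp.out
  haveI : PerfectRing E p := PerfectRing.ofSurjective E p fun y => by
    obtain ⟨b, hb, h⟩ := hperf y y.2
    exact ⟨⟨b, hb⟩, Subtype.ext (by simpa [frobenius] using h)⟩
  haveI : PerfectField E := PerfectRing.toPerfectField E p
  letI : Algebra E T := (Subfield.inclusion hET).toAlgebra
  haveI : Algebra.IsAlgebraic E T := relAlgebraic_of_forall hET halg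
  haveI : PerfectField T := Algebra.IsAlgebraic.perfectField E
  haveI : ExpChar T p := ExpChar.prime hp.out
  intro y hy
  obtain ⟨b, hb⟩ := surjective_frobenius T p ⟨y, hy⟩
  refine ⟨b, b.2, ?_⟩
  have := congrArg Subtype.val hb
  simpa [frobenius] using this

/-- **Elements of a step of degree `p`**: for subfields `E ≤ T ≤ T₁` of `Ω` with `E` perfect,
henselian and of rank one, `T₁` algebraic over `E` and `[T₁ : T] = p` (`IsNormalStep`; normality is
not used), every `β ∈ T₁` has "Krasner radius = distance" over `T` for test elements algebraic over
`E`: `β` lies in `T` or has minimal polynomial of degree `p` over `T` (Temkin 2013, Lemma 3.1.6,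
`DeeplyRamifiedKrasner.lean`). [cite: Temkin2013, Lemma 3.1.6] -/
theorem exists_aroots_valuation_le_of_isNormalStep {E T T₁ : Subfield Ω}
    (hE : IsHenselianField E (V.comap (algebraMap E Ω))) (hperf : ∀ y ∈ E, ∃ b ∈ E, b ^ p = y)
    (hr1 : IsRankOneValued V E) (hET : E ≤ T) (hstep : IsNormalStep p T T₁)
    (halg : ∀ y ∈ T₁, IsAlgebraic E y) {β : Ω} (hβ : β ∈ T₁) {g : Ω} (hgalg : IsAlgebraic E g)
    (hg : ∀ c ∈ T, V.valuation g ≤ V.valuation (β - c)) :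
    ∃ β₂ ∈ (minpoly T β).aroots Ω, V.valuation g ≤ V.valuation (β - β₂) := by
  obtain ⟨hTT₁, hdeg, -⟩ := hstep
  have halgT : ∀ y ∈ T, IsAlgebraic E y := fun y hy => halg y (hTT₁ hy)
  have hβint : IsIntegral T β := (isAlgebraic_of_subfield_le hET (halg β hβ)).isIntegral
  -- `deg_T β ∣ p`
  have hdvd : (minpoly T β).natDegree ∣ p := by
    have h1 : finrank T T⟮β⟯ = (minpoly T β).natDegree := adjoin.finrank hβint
    have h2 : T⟮β⟯ ≤ Subfield.extendScalars hTT₁ := adjoin_simple_le_iff.mpr hβ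
    have h3 := finrank_bot_mul_relfinrank h2
    rw [hdeg, h1] at h3
    exact Dvd.intro _ h3
  rcases (Nat.dvd_prime hp.out).mp hdvd with h1 | hp'
  · -- `β ∈ T`
    have hβT : β ∈ T := by
      obtain ⟨c, hc⟩ := minpoly.natDegree_eq_one_iff.mp h1
      rw [← hc]
      exact c.2
    exact exists_aroots_valuation_le_of_mem V hβT hg
  · -- degree `p`: Lemma 3.1.6 over `T`
    exact exists_aroots_valuation_le_of_natDegree_eq V p (hE.of_subfield_le V hET halgT)
      (forall_exists_pow_eq_of_algebraic p hET hperf halgT) (hr1.of_algebraic V hET halgT) hβint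
      hp' (isAlgebraic_of_subfield_le hET hgalg) hg

/-- **Descending "Krasner radius = distance" along a tower of steps of degree `p`**: for
`E ≤ T ≤ T'` inside `Ω` with `E` perfect, henselian, of rank one, `T'` algebraic over `E`, and
`IsNormalPTower p T T'`, if the property holds for `α` over `T'` then it holds for `α` over `T`
(test elements algebraic over `E`). Induction on the tower with
`exists_aroots_valuation_le_step`. [cite: Temkin2013, Prop. 3.1.7 (proof)] -/
theorem exists_aroots_valuation_le_of_isNormalPTower {E : Subfield Ω}
    (hE : IsHenselianField E (V.comap (algebraMap E Ω))) (hperf : ∀ y ∈ E, ∃ b ∈ E, b ^ p = y)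
    (hr1 : IsRankOneValued V E) {α : Ω} (hα : IsIntegral E α) {T T' : Subfield Ω}
    (htower : IsNormalPTower p T T') :
    E ≤ T → (∀ y ∈ T', IsAlgebraic E y) →
    (∀ g : Ω, IsAlgebraic E g → (∀ c ∈ T', V.valuation g ≤ V.valuation (α - c)) →
      ∃ β ∈ (minpoly T' α).aroots Ω, V.valuation g ≤ V.valuation (α - β)) →
    ∀ g : Ω, IsAlgebraic E g → (∀ c ∈ T, V.valuation g ≤ V.valuation (α - c)) →
      ∃ β ∈ (minpoly T α).aroots Ω, V.valuation g ≤ V.valuation (α - β) := by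
  induction htower with
  | refl T => intro _ _ h; exact h
  | step hstep htw ih =>
    rename_i M M₁ T'
    intro hEM halg hT' g hgalg hg
    have hMM₁ : M ≤ M₁ := hstep.le
    have hM₁T' : M₁ ≤ T' := htw.le
    have halgM₁ : ∀ y ∈ M₁, IsAlgebraic E y := fun y hy => halg y (hM₁T' hy)
    have halgM : ∀ y ∈ M, IsAlgebraic E y := fun y hy => halgM₁ y (hMM₁ hy)
    have hP₁ := ih (hEM.trans hMM₁) halg hT'
    refine exists_aroots_valuation_le_step V hMM₁ (hE.of_subfield_le V hEM halgM)
      (fun y hy => isAlgebraic_of_subfield_le hEM (halgM₁ y hy))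
      (isIntegral_of_subfield_le hEM hα) (fun g => IsAlgebraic E g) hP₁ ?_ hgalg hg
    intro β hβ g' hg'alg hg'
    exact exists_aroots_valuation_le_of_isNormalStep V p hE hperf hr1 hEM hstep halgM₁ hβ hg'alg hg'

end Tower

/-! ### Temkin 2013, Prop. 3.1.7 -/

section Main

variable (p : ℕ) [hp : Fact p.Prime] [CharP Ω p] [CharP (IsLocalRing.ResidueField V) p]

/-- **Temkin 2013, Prop. 3.1.7 (equal characteristic), predicate form.** Let `Ω` be
algebraically closed of characteristic `p` with valuation ring `V` (residue characteristic `p`),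
`E ≤ Ω` a subfield which is henselian, perfect ("deeply ramified") and of rank one, and `α`
algebraic over `E`. Then every `g` algebraic over `E` with `|g| ≤ |α − c|` for all `c ∈ E`
satisfies `|g| ≤ |α − β|` for some `E`-conjugate `β` of `α` — i.e. `inf_{c ∈ E} |α − c|` does not
exceed the Krasner radius `max_β |α − β|` (the reverse inequality being Krasner's lemma). Printed
statement: "Assume that `k` is deeply ramified, and let `α ∈ k^a` be an element with conjugates
`α₁ = α, …, α_d`. Then `max_i |α − αᵢ| = inf_{c ∈ k} |α − c|`." PROVED along a tower
`E ≤ M^P ≤ ⋯ ≤ M` (`M` the splitting field of `minpoly_E α` in `Ω`, Galois over the perfect `E`;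
`P` a `p`-Sylow subgroup of `Gal(M|E)`): the elements of `M^P` have degree prime to `p` over `E`
(trace trick), the steps above `M^P` have degree `p` (Lemma 3.1.6), and the induction step is the
printed one (`exists_aroots_valuation_le_step`). The printed proof uses instead a tower of
unramified / moderately ramified prime degree / wildly ramified degree-`p` steps.
[cite: Temkin2013, Prop. 3.1.7] -/
theorem exists_aroots_valuation_le_of_perfect {E : Subfield Ω}
    (hE : IsHenselianField E (V.comap (algebraMap E Ω))) (hperf : ∀ y ∈ E, ∃ b ∈ E, b ^ p = y)
    (hr1 : IsRankOneValued V E) {α : Ω} (hα : IsIntegral E α) {g : Ω} (hgalg : IsAlgebraic E g)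
    (hg : ∀ c ∈ E, V.valuation g ≤ V.valuation (α - c)) :
    ∃ β ∈ (minpoly E α).aroots Ω, V.valuation g ≤ V.valuation (α - β) := by
  classical
  -- `E` is perfect, hence `minpoly_E α` is separable
  haveI : ExpChar E p := ExpChar.prime hp.out
  haveI : PerfectRing E p := PerfectRing.ofSurjective E p fun y => by
    obtain ⟨b, hb, h⟩ := hperf y y.2
    exact ⟨⟨b, hb⟩, Subtype.ext (by simpa [frobenius] using h)⟩
  haveI : PerfectField E := PerfectRing.toPerfectField E p
  set f : E[X] := minpoly E α with hf
  have hfsep : f.Separable := PerfectField.separable_of_irreducible (minpoly.irreducible hα)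
  have hsplits : (f.map (algebraMap E Ω)).Splits := IsAlgClosed.splits _
  -- the splitting field `M` of `f` inside `Ω`: finite Galois over `E`, containing `α`
  set M : IntermediateField E Ω := adjoin E (f.rootSet Ω) with hM
  haveI hsf : f.IsSplittingField E M := adjoin_rootSet_isSplittingField hsplits
  haveI : FiniteDimensional E M := Polynomial.IsSplittingField.finiteDimensional M f
  haveI : IsGalois E M := IsGalois.of_separable_splitting_field hfsep
  have hαM : α ∈ M := by
    refine subset_adjoin E (f.rootSet Ω) ?_
    rw [mem_rootSet]
    exact ⟨minpoly.ne_zero hα, minpoly.aeval E α⟩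
  have halgM : ∀ y ∈ M.toSubfield, IsAlgebraic E y := fun y hy =>
    ((IsIntegral.of_finite E (⟨y, hy⟩ : M)).map (IsScalarTower.toAlgHom E M Ω)).isAlgebraic
  -- a `p`-Sylow subgroup `P` of `Gal(M|E)` and its fixed field `S = M^P`
  set G := M ≃ₐ[E] M
  obtain ⟨P⟩ : Nonempty (Sylow p G) := inferInstance
  set S : IntermediateField E M := fixedField (P : Subgroup G) with hS
  set K₁ : Subfield Ω := (lift S).toSubfield with hK₁
  have hEK₁ : E ≤ K₁ := le_lift_toSubfield S
  have hK₁M : K₁ ≤ M.toSubfield := lift_toSubfield_le S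
  have halgK₁ : ∀ y ∈ K₁, IsAlgebraic E y := fun y hy => halgM y (hK₁M hy)
  -- (1) `M` is reached from `K₁ = M^P` by steps of degree `p`
  haveI := finiteDimensional_extendScalars_lift S
  haveI := isGalois_extendScalars_lift S
  have hPgrp : IsPGroup p
      (Subfield.extendScalars (lift_toSubfield_le S) ≃ₐ[(lift S).toSubfield]
        Subfield.extendScalars (lift_toSubfield_le S)) := by
    refine isPGroup_extendScalars_lift S ?_
    rw [hS, fixingSubgroup_fixedField]
    exact P.isPGroup'
  have htower : IsNormalPTower p K₁ M.toSubfield := by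
    have h := isNormalPTower_top_of_isGalois_of_isPGroup (lift S).toSubfield
      (Subfield.extendScalars (lift_toSubfield_le S)) hPgrp
    rwa [Subfield.extendScalars_toSubfield] at h
  -- (2) over `M` itself the property is trivial (`α ∈ M`), hence it holds over `K₁`
  have hPM : ∀ g : Ω, IsAlgebraic E g →
      (∀ c ∈ M.toSubfield, V.valuation g ≤ V.valuation (α - c)) →
      ∃ β ∈ (minpoly M.toSubfield α).aroots Ω, V.valuation g ≤ V.valuation (α - β) :=
    fun g _ hgc => exists_aroots_valuation_le_of_mem V (K := M.toSubfield) hαM hgc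
  have hPK₁ := exists_aroots_valuation_le_of_isNormalPTower V p hE hperf hr1 hα htower hEK₁
    halgM hPM
  -- (3) the elements of `K₁ = M^P` have degree prime to `p` over `E`: trace trick
  have hK₁deg : ∀ β ∈ K₁, ¬ p ∣ (minpoly E β).natDegree := by
    intro β hβ hdvd
    have hβint : IsIntegral E β := (halgK₁ β hβ).isIntegral
    have hβlift : β ∈ lift S := hβ
    have h1 : finrank E E⟮β⟯ = (minpoly E β).natDegree := adjoin.finrank hβint
    have h2 : E⟮β⟯ ≤ lift S := adjoin_simple_le_iff.mpr hβlift
    have h3 := finrank_bot_mul_relfinrank h2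
    have h4 : finrank E (lift S) = (P : Subgroup G).index := by
      rw [← (liftAlgEquiv S).toLinearEquiv.finrank_eq, hS,
        IntermediateField.finrank_eq_fixingSubgroup_index, fixingSubgroup_fixedField]
    haveI : (P : Subgroup G).FiniteIndex := Subgroup.finiteIndex_of_finite
    have hndvd : ¬ p ∣ (P : Subgroup G).index := P.not_dvd_index
    refine hndvd ?_
    rw [← h4, ← h3, h1]
    exact Dvd.dvd.mul_right hdvd _
  have hPβ : ∀ β ∈ K₁, ∀ g : Ω, IsAlgebraic E g →
      (∀ c ∈ E, V.valuation g ≤ V.valuation (β - c)) →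
      ∃ β₂ ∈ (minpoly E β).aroots Ω, V.valuation g ≤ V.valuation (β - β₂) := by
    intro β hβ g _ hgc
    refine exists_aroots_valuation_le_of_valuation_natDegree_eq_one V (halgK₁ β hβ).isIntegral
      ?_ hgc
    refine valuation_natCast_eq_one_of_residue_ne_zero V fun h0 => hK₁deg β hβ ?_
    exact (CharP.cast_eq_zero_iff (IsLocalRing.ResidueField V) p _).mp h0
  -- (4) the last step `E ≤ K₁`
  exact exists_aroots_valuation_le_step V hEK₁ hE halgK₁ hα (fun g => IsAlgebraic E g) hPK₁ hPβ
    hgalg hg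

/-- **Temkin 2013, Prop. 3.1.7 (equal characteristic): over a deeply ramified field of height one,
the Krasner radius of every algebraic `α` is its distance to the field.** Under the hypotheses of
`exists_aroots_valuation_le_of_perfect` there is a conjugate `β₀` of `α` (a root of its minimal
polynomial over `E`) at maximal distance `ρ = |α − β₀| = max_β |α − β|`, and `ρ = inf_{c ∈ E} |α − c|`
in the sense of `DeeplyRamifiedKrasner.lean`: `ρ ≤ |α − c|` for every `c ∈ E` (Krasner's lemma,
`valuation_sub_le_of_mem_aroots_minpoly`), and for every `g` algebraic over `E` with `|g| > ρ` some
`c ∈ E` has `|α − c| < |g|`. This extends `exists_conj_krasnerRadius_eq_dist_of_perfect`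
(Lemma 3.1.6: `deg minpoly_E α = p`) to all algebraic `α`. PROVED. [cite: Temkin2013, Prop. 3.1.7] -/
theorem exists_conj_krasnerRadius_eq_dist_of_isIntegral_of_perfect {E : Subfield Ω}
    (hE : IsHenselianField E (V.comap (algebraMap E Ω))) (hperf : ∀ y ∈ E, ∃ b ∈ E, b ^ p = y)
    (hr1 : IsRankOneValued V E) {α : Ω} (hα : IsIntegral E α) :
    ∃ β₀ ∈ (minpoly E α).aroots Ω,
      (∀ β ∈ (minpoly E α).aroots Ω, V.valuation (α - β) ≤ V.valuation (α - β₀)) ∧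
      (∀ c ∈ E, V.valuation (α - β₀) ≤ V.valuation (α - c)) ∧
      ∀ g : Ω, IsAlgebraic E g → V.valuation (α - β₀) < V.valuation g →
        ∃ c ∈ E, V.valuation (α - c) < V.valuation g := by
  obtain ⟨β₀, hβ₀, hmax⟩ := exists_max_aroots_minpoly V hα
  refine ⟨β₀, hβ₀, hmax, fun c hc => valuation_sub_le_of_mem_aroots_minpoly V hE hα hβ₀ hc, ?_⟩
  intro g hgalg hlt
  by_contra hcon
  push Not at hcon
  obtain ⟨β, hβ, hle⟩ := exists_aroots_valuation_le_of_perfect V p hE hperf hr1 hα hgalg hcon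
  exact absurd (hle.trans (hmax β hβ)) (not_le.mpr hlt)

end Main

end Literature.AlgebraicGeometry.Resolution
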